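import Summits.BirchSwinnertonDyer.BirchSwinnertonDyer.Theorems.SchneiderFreeAdditiveX3UpperWingGordOfPrintRHPWL
import Summits.BirchSwinnertonDyer.BirchSwinnertonDyer.Theorems.SchneiderFreeAdditiveX3UpperGordCellThreeAnomalousOfPartnerClassTree
import HarnessLib

/-!
# Route `SchneiderFreeAdditiveX3Upper` (K1 wing): crux r3 `GordTwoBranchCoIMCField` BY NAME and the UPPER half per pair at every odd `p` WITHOUT any statement of
# Keller–Yin arXiv:2402.12781 — the `μ`-input on the 1 725 anomalous pairs at `p = 3` from Bleher et al. 2020 Thm. 3.3.1, de Shalit II.6.4, Hida Thm I on the tree's Milne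
# ADT I 4.10 (a) (FILE 9 of generation 41's [RH] re-key; twins of generation 29's `UpperWingGordOfPrintRHPWL`)

Cell `bsd-schneider-ideate`, seat `bsd-schneider-door-c5` (prover, generation 41; assembly layer; `--supports` 19177, helper — record work for the wing crux 20365, whose seat is
parked).  PARTITION: board row B6 ∩ X3 ∩ sst-twist, `r = 1`, the WHOLE (G-ord, `e = 2`) half (2 560 census pairs) of `Rank1Residual.partition` — ASSEMBLY; types-the-object-of
nothing; closes none of B6's cells (BSD NOT advanced).  bears_on: K1-wing (route `SchneiderFreeAdditiveX3Upper`, crux 20365 `GordTwoBranchCoIMCField`), K1-door (19177).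
* §1 `gordTwoBranchCoIMCField_of_hsieh_of_lzz_of_KY_dvd_of_prop14_of_tree_of_castellaHsieh_signed` — WING CRUX r3 BY NAME ⇐ Kolyvagin ∧ modularity ∧ Hsieh A ∧ LZZ ∧ Castella–Hsieh
  signed ∧ CGLS 2022 Prop. 14 ∧ [DIV.dvd] (Keller–Yin 2410.23241, the ONE preprint input) ∧ Bleher et al. 3.3.1 ∧ de Shalit II.6.4 ∧ Hida Thm I; §2 the same with Prop. 14
  from Prop. 1.2.5's module clause; §3 the UPPER half per pair on the whole cell at every odd `p` from the twist-unit datum.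
INPUT LEDGER of the wing crux BY NAME after this file: {Kolyvagin, modularity, Hsieh A, LZZ, Castella–Hsieh signed, CGLS Prop 14 (or Prop 1.2.5 module clause), Bleher et al.
3.3.1, de Shalit II.6.4, Hida Thm I} ∪ {[DIV.dvd] PRE} — 9 refereed + 1 preprint clause; nothing from arXiv:2402.12781 (generation 29: 8 named with [RH], [PWL-θ]).
HONEST FRAMING: compositions of tree theorems, CONDITIONAL BY NAME; the wing crux stays OPEN (a `conditional-result`); no definition, no named fact, no `sorry`; BSD proved
for no curve; «closes rung: none».  References: [KellerYin2024b] Thm. 3.3.6 ∘ Prop. 3.4.4; [CastellaGrossiLeeSkinner2022] Props. 1.2.5, 14; [BleherEtAl2020] Thm. 3.3.1;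
[deShalit1987] II.6.4; [Hida2010MuInvariant] Thm. I; [CastellaHsieh2018] §3.3; [Hsieh2014] Thm. A; [LiuZhangZhang2018]; [Ribet1976] Prop. 2.1; [MilneADT2006] I Thm. 4.10 (a);
this seat gen 23/25/29 (`…UpperWingGordOfPrintRHPWL`), F47f/F47g (gen 41).
-/

set_option autoImplicit false
set_option linter.dupNamespace false -- the summit namespace `…BirchSwinnertonDyer.BirchSwinnertonDyer.Theorems` (Sub = Summit, D-0017) trips it

noncomputable section

open scoped Classical NumberField

open Field NumberField IsDedekindDomain WeierstrassCurve
  Literature.NumberTheory.EllipticCurves Literature.NumberTheory.EllipticCurves.GreenbergSelmer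
  Literature.NumberTheory.GaloisRepresentations Literature.NumberTheory.GaloisCohomology
  Literature.NumberTheory.EllipticCurves.ModularForms Literature.NumberTheory.EllipticCurves.Rank1Residual
  Literature.NumberTheory.EllipticCurves.Rank1Residual.Typed
  Literature.NumberTheory.EllipticCurves.IwasawaAlgebra
  Literature.NumberTheory.EllipticCurves.KellerYin2024 Literature.NumberTheory.EllipticCurves.CaiShuTian2014
  Summit.BirchSwinnertonDyer.Rank1Residual Summit.BirchSwinnertonDyer.Rank1Residual.Additive
  Summit.BirchSwinnertonDyer.Rank1Residual.X11b
  Summit.BirchSwinnertonDyer.Rank1Residual.X11b.AcSelmer Summit.BirchSwinnertonDyer.Rank1Residual.X11b.Halves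
  Summit.BirchSwinnertonDyer.BirchSwinnertonDyer.Theorems
  Summit.BirchSwinnertonDyer.BirchSwinnertonDyer.Theorems.SchneiderFree
  Summit.BirchSwinnertonDyer.BirchSwinnertonDyer.Theorems.SchneiderFree.Upper
  Summit.BirchSwinnertonDyer.BirchSwinnertonDyer.Theorems.SchneiderFreeAdditiveX3
  Summit.BirchSwinnertonDyer.BirchSwinnertonDyer.Theorems.SchneiderFreeAdditiveX3.UpperOfPrint
  Summit.BirchSwinnertonDyer.BirchSwinnertonDyer.Theorems.SchneiderFreeAdditiveX3.UpperOfPrintDvd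
  Summit.BirchSwinnertonDyer.BirchSwinnertonDyer.Theorems.SchneiderFreeAdditiveX3.UpperOfPrintNonAnomalousTwist
  Summit.BirchSwinnertonDyer.BirchSwinnertonDyer.Theorems.SchneiderFreeAdditiveX3.UpperThreeAnomalousOfPartnerClass

open Literature.NumberTheory.EllipticCurves.BCGKPST2020 Literature.NumberTheory.EllipticCurves.DeShalit1987
  Literature.NumberTheory.EllipticCurves.Hida2010MuInvariant
open Literature.NumberTheory.EllipticCurves.CastellaGrossiLeeSkinner2022 (prop14_residualCharacterSelmer_finite
  prop125_characterGrSelmerDual_torsion_muZero_dim)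
open Summit.BirchSwinnertonDyer.BirchSwinnertonDyer.Theorems.TeichmullerPairUnramifiedAtMult (prop14_residualCharacterSelmer_finite_of_fact)

open Summit.BirchSwinnertonDyer.BirchSwinnertonDyer.Theses.SchneiderFreeAdditiveX3Upper

open Summit.BirchSwinnertonDyer.BirchSwinnertonDyer.Theorems.SchneiderFreeAdditiveX3.UpperWingGordOfPrintRHPWL

namespace Summit.BirchSwinnertonDyer.BirchSwinnertonDyer.Theorems.SchneiderFreeAdditiveX3.UpperWingGordOfTree

/-! ### §1 WING CRUX r3 BY NAME without [RH]/[PWL-θ] -/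

/-- **WING CRUX r3 `GordTwoBranchCoIMCField` BY NAME ⇐ Kolyvagin ∧ modularity ∧ Hsieh 2014 Thm. A ∧ Liu–Zhang–Zhang 2018 ∧ Castella–Hsieh signed existence ∧ CGLS 2022 Prop. 14
(ALL PUBLISHED) ∧ [DIV.dvd] (Keller–Yin 2410.23241 Thm. 3.3.6 ∘ Prop. 3.4.4 — the ONE preprint input) ∧ Bleher et al. 2020 Thm. 3.3.1 ∧ de Shalit II.6.4 ∧ Hida Thm I (PUBLISHED;
they replace [RH]/[PWL-θ] of Keller–Yin 2402.12781 as the `μ`-input on the anomalous pairs at `p = 3`, FILES 6–7).**  Generation 29's theorem re-keyed; proof token-identical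
except the anomalous branch at `p = 3` (FILE 7 §1).  CONDITIONAL BY NAME; the item stays OPEN (a `conditional-result`); nothing asserted about BSD.
[cite: KellerYin2024b, Thm. 3.3.6 and Prop. 3.4.4, divisibility clause (arXiv:2410.23241 p. 19) (preprint; hypothesis)] [cite: CastellaGrossiLeeSkinner2022, §1.2 Prop. 14]
[cite: BleherEtAl2020, §3.3 Thm. 3.3.1] [cite: deShalit1987, II.6.4] [cite: Hida2010MuInvariant, Thm. I] [cite: CastellaHsieh2018, §3.3, Def. 3.7 and Prop. 3.8]
[cite: Hsieh2014, Thm. A p. 712] [cite: LiuZhangZhang2018, Thm 1.5.1 and Thm 1.5.3] [cite: Ribet1976, Prop. 2.1] -/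
theorem gordTwoBranchCoIMCField_of_hsieh_of_lzz_of_KY_dvd_of_prop14_of_tree_of_castellaHsieh_signed
    (hKo : ∀ (N : ℕ) [NeZero N] (W : WeierstrassCurve ℚ) (K : Type) [Field K] [NumberField K],
      Literature.NumberTheory.EllipticCurves.kolyvagin N W K)
    (hPar : nonempty_modularParametrizationData)
    (hA : Hsieh2014.thmA_exists_isHsiehLFunction_unrPeriod_anyLevel)
    (hL : LiuZhangZhang2018.thm151_thm153_modularCurve_heegnerVector_additive)
    (hdvd : thm336_dvd_branch_OPEN) (h14 : prop14_residualCharacterSelmer_finite)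
    (hCHσ : castellaHsieh2018_exists_isBranchBDPLFunction_signed)
    (h331 : thm331_rubin_exists_katzMeasure₂_pseudoIso_span_eq)
    (hFE : thmII64_katzMeasure₂_functionalEquation) (hO1 : thmI_mu_katzBranch_reflect_eq_zero) :
    GordTwoBranchCoIMCField := by
  intro W _ _ p _ hp2 hX hSG hlat K _ _ _ hdK
  have hp : p.Prime := Fact.out
  by_cases h3 : p = 3
  · subst h3
    rcases UpperThreeAnomalousOfPartnerClass.forall_twist_not_anomalous_or_exists_anomalous_twist W hX hSG with hNAT | ⟨V₀, _, _, C₀, hord₀, hC₀, hanom₀⟩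
    · exact additiveIMCUpperBDPInputManinAtField_of_hsieh_of_lzz_of_KY_dvd_of_prop14_of_castellaHsieh_signed_of_forall_twist hKo hPar hA hL hdvd h14
        hCHσ hp2 hX hSG hNAT hlat K hdK
    · obtain ⟨V, _, _, hV, hord, hanom, hlatV⟩ :=
        UpperThreeAnomalousOfPartnerClass.exists_partnerClass_of_anomalous_twist_model hX.1 C₀ hC₀ hord₀ hanom₀
      exact UpperThreeAnomalousOfPartnerClassTree.additiveIMCUpperBDPInputManinAtField_three_of_tree_of_partnerClass hKo hPar hA hL hdvd hCHσ h331 hFE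
        hO1 hX hSG hlat hV hord hanom hlatV K hdK
  · have hp5 : 5 ≤ p := by
      have h2 := hp.two_le
      have h4 : p ≠ 4 := by rintro rfl; exact absurd hp (by decide)
      omega
    exact UpperOfPrintDvd.additiveIMCUpperBDPInputManinAtField_of_hsieh_of_lzz_of_KY_dvd_of_prop14_of_castellaHsieh_signed hKo hPar hA hL hdvd h14
      hCHσ hp5 hX hSG hlat K hdK


/-! ### §2 The same with CGLS Prop. 14 from Prop. 1.2.5's module clause -/

/-- **WING CRUX r3 BY NAME, CGLS's finiteness clause supplied from its module clause** (`prop14_residualCharacterSelmer_finite_of_fact`), no [RH]/[PWL-θ].  CONDITIONAL BY NAME;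
nothing asserted about BSD. [cite: CastellaGrossiLeeSkinner2022, §1.2 Prop. 1.2.5 and Lemma 1.2.4] [cite: KellerYin2024b, Thm. 3.3.6 and Prop. 3.4.4 (preprint; hypothesis)]
[cite: BleherEtAl2020, §3.3 Thm. 3.3.1] [cite: deShalit1987, II.6.4] [cite: Hida2010MuInvariant, Thm. I] -/
theorem gordTwoBranchCoIMCField_of_hsieh_of_lzz_of_KY_dvd_of_prop125dim_of_tree_of_castellaHsieh_signed
    (hKo : ∀ (N : ℕ) [NeZero N] (W : WeierstrassCurve ℚ) (K : Type) [Field K] [NumberField K],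
      Literature.NumberTheory.EllipticCurves.kolyvagin N W K)
    (hPar : nonempty_modularParametrizationData)
    (hA : Hsieh2014.thmA_exists_isHsiehLFunction_unrPeriod_anyLevel)
    (hL : LiuZhangZhang2018.thm151_thm153_modularCurve_heegnerVector_additive)
    (hdvd : thm336_dvd_branch_OPEN) (h125 : prop125_characterGrSelmerDual_torsion_muZero_dim)
    (hCHσ : castellaHsieh2018_exists_isBranchBDPLFunction_signed)
    (h331 : thm331_rubin_exists_katzMeasure₂_pseudoIso_span_eq)
    (hFE : thmII64_katzMeasure₂_functionalEquation) (hO1 : thmI_mu_katzBranch_reflect_eq_zero) :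
    GordTwoBranchCoIMCField :=
  gordTwoBranchCoIMCField_of_hsieh_of_lzz_of_KY_dvd_of_prop14_of_tree_of_castellaHsieh_signed hKo hPar hA hL hdvd
    (prop14_residualCharacterSelmer_finite_of_fact h125) hCHσ h331 hFE hO1


/-! ### §3 Per pair on the WHOLE (G-ord, `e = 2`) cell at EVERY odd `p`: the UPPER half from the twist-unit datum alone, no [RH]/[PWL-θ] -/

/-- **UPPER half per pair on the WHOLE (G-ord, `e = 2`) cell at EVERY ODD `p` from the twist-unit datum ALONE** ⇐ `PrintedFacts` ∧ Hsieh A ∧ LZZ ∧ CGLS Prop. 14 ∧ Castella–Hsieh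
signed ∧ [DIV.dvd] (preprint) ∧ Bleher et al. 3.3.1 ∧ de Shalit II.6.4 ∧ Hida Thm I (used at `p = 3` only) — `p ≥ 5`: generation 23 verbatim; `p = 3`: FILE 7.  CONDITIONAL BY
NAME; the LOWER half is not here; closes no item; BSD not advanced. [cite: CastellaGrossiLeeSkinner2022, §1.2 Prop. 14]
[cite: KellerYin2024b, Thm. 3.3.6 and Prop. 3.4.4, divisibility clause (arXiv:2410.23241 p. 19) (preprint; hypothesis)] [cite: BleherEtAl2020, §3.3 Thm. 3.3.1]
[cite: JetchevSkinnerWan2017, §7.4.1] [cite: CastellaHsieh2018, §3.3, Def. 3.7 and Prop. 3.8] [cite: Miller2011LMS, Def. 1.1] -/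
theorem missingUpperBoundAt_gordTwo_odd_of_printedFacts_of_twistUnitAt_of_tree
    (hF : PrintedFacts) (hA : Hsieh2014.thmA_exists_isHsiehLFunction_unrPeriod_anyLevel)
    (hL : LiuZhangZhang2018.thm151_thm153_modularCurve_heegnerVector_additive)
    (hdvd : thm336_dvd_branch_OPEN) (h14 : prop14_residualCharacterSelmer_finite)
    (hCHσ : castellaHsieh2018_exists_isBranchBDPLFunction_signed)
    (h331 : thm331_rubin_exists_katzMeasure₂_pseudoIso_span_eq)
    (hFE : thmII64_katzMeasure₂_functionalEquation) (hO1 : thmI_mu_katzBranch_reflect_eq_zero) :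
    ∀ (W : WeierstrassCurve ℚ) [W.IsElliptic] [W.IsGloballyMinimal] (p : ℕ) [Fact p.Prime],
      p ≠ 2 → W.analyticRank = 1 → ClassX3 W p → Additive.SubGordTwo W p → Upper.TwistUnitFieldOffSliverAt W p →
      MissingUpperBoundAt W p := by
  intro W _ _ p _ hp2 hr hX hG hTU
  have hp : p.Prime := Fact.out
  by_cases h3 : p = 3
  · subst h3
    exact UpperThreeAnomalousOfPartnerClassTree.missingUpperBoundAt_gordTwo_three_of_printedFacts_of_twistUnitAt_of_tree
      hF hA hL hdvd h14 hCHσ h331 hFE hO1 W hr hX hG hTU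
  · have hp5 : 5 ≤ p := by
      have h2 := hp.two_le
      have h4 : p ≠ 4 := by rintro rfl; exact absurd hp (by decide)
      omega
    exact UpperOfPrintDvd.missingUpperBoundAt_gordTwo_fiveLe_of_printedFacts_of_twistUnitAt_of_hsieh_of_lzz_of_KY_dvd_of_prop14_of_castellaHsieh_signed
      hF hA hL hdvd h14 hCHσ W p hp5 hr hX hG hTU


end Summit.BirchSwinnertonDyer.BirchSwinnertonDyer.Theorems.SchneiderFreeAdditiveX3.UpperWingGordOfTree

end
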